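import Summits.QuantumFields.YangMills.Theorems.BalabanUVNodesN15CurvedGluingSpeciesCommutatorAdjoint
import HarnessLib

/-!
# Route «BalabanUVNodes» (cluster K4 «SpineRates»), Track-A DAG node N15 = NE2, BACKGROUND LAYER — THE η-DEFECT OF THE ADJOINT SPECIES COMMUTATOR ROW `𝔇(G′∘[V′, M_{h′}], G∘[V, M_h])`
# FROM THE CUBE's RIGHT-ENTRY DEFECTS (dag-n15-c FILE 53 `hasMaj_idef_comp_commOp_covLapM`'s `r_W` ∕ FILE 49 `hasMaj_idef_remainderL`'s `hDK`, species part)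

Cell `pub-ymgap`, seat `pub-ymgap-dag-n15-w3` (WIDTH SEAT 3∕3 on node N15, director-ym №197 ∕ HUMAN RULING D-0149; plan `W-SEAT-START-LIST.md` §n15 item 3 — fifteenth piece; with files 12–14 the
species `W = ±V` now has all FOUR rows dag-n15-c's gluing bundle displays: left letter (12), left η-defect (13), right letter (14), right η-defect (this file)).  `bears_on: R4∕N15 · K3⁷
SpineGivenEndpointR13SepCoPH (stmt-QuantumFields-20544)`.  Filed `--kind proof --supports stmt-QuantumFields-20544 --as helper` — COUNT-NEUTRAL.  Theorems only; 0 `sorry`.  Imports BY NAME file 14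
`…N15CurvedGluingSpeciesCommutatorAdjoint` (`comp_commOp_speciesOpM`, `comp_commOp_neg`, `sum_abs_smul_row_le`; through it file 12, dag-n15-c FILES 45∕46 `commOp`, `idef_fsum`, `idef_neg`, `hasMaj_comp_diag`,
`hasMaj_fsum`, lit `T4EtaRateDefect.idef`∕`idef_comp`∕`idef_add`∕`idef_sub`, `T4EtaRateCoeffDefect.pull`, n15-b `mmulOp`∕`liftMap`∕`liftBlk`∕`liftEquiv`∕`hasMaj_mmulOp`∕`hasMaj_idef_mmulOp`); nothing in
the tree is modified.

WHY.  File 14's exact expansion `G∘[V, M_h] = Σ_μ[G∘M_{B₁} + (G∘∇⁺)∘M_{B₂} + G∘M_{B₃} − (G∘∇⁻)∘M_{B₄}]` (`B₁ = ∇⁻h·(A⁺∘τ⁻¹)`, `B₂ = δ⁻h·(A⁺∘τ⁻¹)`, `B₃ = ∇⁺h·(A⁻∘τ)`, `B₄ = δ⁺h·(A⁻∘τ)`)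
holds on both grids, so the η-defect is a sum of terms `𝔇(T′∘M_{B′}, T∘M_B) = T′∘𝔇(M_{B′}, M_B) + 𝔇(T′, T)∘M_B` (`idef_comp`): the FINE right entry `T′ ∈ {G′, G′∘∇′^±}` times the DIAGONAL
coefficient fit `𝔇(M_{B′}, M_B) ≤ 1_{y=y′}·o_B` (n15-b `hasMaj_idef_mmulOp`), plus the right-entry defect `𝔇(T′, T)` times the COARSE coefficient rows `r_B` — dag-n15-c FILE 53's one-term shape
`hasMaj_idef_comp_mulOp_loc` (`βo + mc`) for matrix coefficients.  The composite fits are Leibniz: `rows(w′·M′ − w·M) ≤ |w′|·rows(M′ − M) + |w′ − w|·rows(M)`, so only these letters appear: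
the FINE partition letters `c₁ = |∇′^±h′|`, `c₀ = |h′∘τ′ − h′|`, the partition fits `o₁` (of `∇^±h` along `π`), `o₀` (of `h∘τ^{±1} − h`), the COARSE coefficient rows `r_A`, the TRANSLATED
coefficient fits `Σ_k|A′^±(τ′^{∓1}x′) − A^±(τ^{∓1}(πx′))|_{ik} ≤ o_At` (dag-n15-c's `hasMaj_idef_mmulOp_translate` letter; `≤ o_A + η·(gradient letter)` under block-neighbour compatibility, file 7
`fitTranslated_of_fit_of_compat`), the fine right entries `β, β₁` and their two-grid defects `m₀, m₁`:
`r_V = |J|·2·(r_A(c₁m₀ + o₁β + c₀m₁ + o₀β₁) + o_At(c₁β + c₀β₁))` — the same shape as the left defect of file 13.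

* §1 `sum_abs_smul_row_fit_le` (the product fit), ★ `hasMaj_idef_comp_mmulOp_loc` (`𝔇(T′∘M_{B′}, T∘M_B) ≤ 1_S1_S·(βo_B + m·r_B)e^{−δd}`);
* §2 ★★ `hasMaj_idef_comp_commOp_speciesOpM` — FILE 53's `r_W` for `W = V`; ★ `hasMaj_idef_comp_commOp_neg_speciesOpM` (`W = −V`).

HONEST FRAMING ∕ LIMITS.  Lattice Leibniz bookkeeping in dag-n15-c's row currency (no estimate); the right entries, their defects and every letter are DISPLAYED ((3.35)–(3.37) p. 396,
(3.52)–(3.53) p. 400, (2.91)–(2.92) p. 239, (2.133)–(2.134) p. 247, Thm 3.14 pp. 426–427 difference template = SHAPES ∕ MECHANISM); the `Q*aQ`∕`DRD*` rows are dag-n15-c's ∕ open; nothing of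
[B6]∕[B9] asserted.  NE2⁺ NOT PRINTED, NOT proved; N15 NOT discharged; counts of record UNMOVED (typed 28∕28 · discharged 5∕27); one finite 𝕋⁴ at fixed ε — NOT infinite volume, NOT OS on ℝ⁴,
NOT a mass gap, NOT Clay; R4 closes the conditional finite-𝕋⁴ rung `BalabanLadder.UV` only.  Restate-immune (no Theses import).
-/

set_option autoImplicit false

noncomputable section
open scoped BigOperators
open Finset

namespace Summit.QuantumFields.YangMills.BalabanUVNodes.N15.CurvedSpecies

open Literature.MathematicalPhysics.QuantumFieldTheory.Balaban1983to89
open Literature.MathematicalPhysics.QuantumFieldTheory.Balaban1983to89.B11SectG (BlockNorm HasMaj)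
open Literature.MathematicalPhysics.QuantumFieldTheory.Balaban1983to89.T4EtaRateDefect (idef idef_comp idef_add idef_sub)
open Literature.MathematicalPhysics.QuantumFieldTheory.Balaban1983to89.T4EtaRateCoeffDefect (pull diagK diagK_nonneg)
open Literature.MathematicalPhysics.QuantumFieldTheory.Balaban1983to89.B6Prop26Gluing (mulOp ind ind_nonneg)
open Summit.QuantumFields.YangMills.BalabanUVNodes.N15.MatrixSpecies (mmulOp liftMap liftBlk liftEquiv hasMaj_mmulOp hasMaj_idef_mmulOp)
open Summit.QuantumFields.YangMills.BalabanUVNodes.N15.BackgroundLayer (fgrad bgrad speciesOpM)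
open Summit.QuantumFields.YangMills.BalabanUVNodes.N15.Gluing (commOp hasMaj_comp_diag hasMaj_fsum idef_fsum idef_neg)

/-! ## §1 The product fit and the one-term defect `𝔇(T′∘M_{B′}, T∘M_B)` -/

section Pieces

variable {ι : Type} [Fintype ι]

/-- THE PRODUCT FIT: `Σ_k|(w′·M′)_{ik} − (w·M)_{ik}| ≤ |w′|·Σ_k|M′ − M|_{ik} + |w′ − w|·Σ_k|M_{ik}| ≤ c·o_M + o_w·r`. [folklore] -/
theorem sum_abs_smul_row_fit_le {w w' c oM ow r : ℝ} {M M' : Matrix ι ι ℝ} (hc : 0 ≤ c) (hw' : |w'| ≤ c) (i : ι) (hfit : ∑ k, |M' i k - M i k| ≤ oM) (how : |w' - w| ≤ ow)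
    (hM : ∑ k, |M i k| ≤ r) : ∑ k, |(w' • M') i k - (w • M) i k| ≤ c * oM + ow * r := by
  have hs : 0 ≤ ∑ k, |M i k| := Finset.sum_nonneg fun _ _ => abs_nonneg _
  have hs' : 0 ≤ ∑ k, |M' i k - M i k| := Finset.sum_nonneg fun _ _ => abs_nonneg _
  calc ∑ k, |(w' • M') i k - (w • M) i k| ≤ ∑ k, (|w'| * |M' i k - M i k| + |w' - w| * |M i k|) := Finset.sum_le_sum fun k _ => by
          have : (w' • M') i k - (w • M) i k = w' * (M' i k - M i k) + (w' - w) * M i k := by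
            simp only [Matrix.smul_apply, smul_eq_mul]
            ring
          rw [this]
          exact (abs_add_le _ _).trans (le_of_eq (by rw [abs_mul w', abs_mul (w' - w)]))
    _ = |w'| * ∑ k, |M' i k - M i k| + |w' - w| * ∑ k, |M i k| := by rw [Finset.sum_add_distrib, Finset.mul_sum, Finset.mul_sum]
    _ ≤ c * oM + ow * r := add_le_add (mul_le_mul hw' hfit hs' hc) (mul_le_mul how hM hs ((abs_nonneg _).trans how))

variable {X X' : Type} [Fintype X] [Fintype X'] {g : B6.Geometry} (blk : X → g.Site) (π : X' → X)

/-- ★ ONE TERM, COEFFICIENT ON THE RIGHT (dag-n15-c FILE 53 `hasMaj_idef_comp_mulOp_loc` for MATRIX coefficients): `𝔇(T′∘M_{B′}, T∘M_B) = T′∘𝔇(M_{B′}, M_B) + 𝔇(T′, T)∘M_B ≤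
1_S1_S·(β·o_B + m·r_B)·e^{−δd}` from the FINE right entry `T′ ≤ 1_S1_S·βe^{−δd}` (`β ≥ 0`; fine blocks `liftBlk blk ι ∘ liftMap π ι`), the coefficient fit `Σ_k|B′(x′) − B(πx′)|_{ik} ≤ o_B`, the defect
`𝔇(T′, T) ≤ 1_S1_S·me^{−δd}` (`m ≥ 0`) and the COARSE rows `Σ_k|B(x)_{ik}| ≤ r_B`. [cite: Balaban1985BackgroundPropagators, Thm 3.14 pp.426–427 (difference template: shape)] -/
theorem hasMaj_idef_comp_mmulOp_loc {T : (X × ι → ℝ) →ₗ[ℝ] (X × ι → ℝ)} {T' : (X' × ι → ℝ) →ₗ[ℝ] (X' × ι → ℝ)} {B : X → Matrix ι ι ℝ} {B' : X' → Matrix ι ι ℝ} {S : Set g.Site}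
    {β oB m rB δ : ℝ} (hβ : 0 ≤ β) (hoB : 0 ≤ oB) (hm : 0 ≤ m) (hrB : 0 ≤ rB) (hB : ∀ x i, ∑ k, |B x i k| ≤ rB) (hfit : ∀ x' i, ∑ k, |B' x' i k - B (π x') i k| ≤ oB)
    (hT' : HasMaj (BlockNorm.ofBlocks g (liftBlk blk ι ∘ liftMap π ι)) (BlockNorm.ofBlocks g (liftBlk blk ι ∘ liftMap π ι)) T'
      (fun y y' => ind S y * ind S y' * (β * Real.exp (-(δ * g.dist y y')))))
    (hDT : HasMaj (BlockNorm.ofBlocks g (liftBlk blk ι)) (BlockNorm.ofBlocks g (liftBlk blk ι ∘ liftMap π ι)) (idef (pull (liftMap π ι)) (pull (liftMap π ι)) T' T)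
      (fun y y' => ind S y * ind S y' * (m * Real.exp (-(δ * g.dist y y'))))) :
    HasMaj (BlockNorm.ofBlocks g (liftBlk blk ι)) (BlockNorm.ofBlocks g (liftBlk blk ι ∘ liftMap π ι))
      (idef (pull (liftMap π ι)) (pull (liftMap π ι)) (T' ∘ₗ mmulOp B') (T ∘ₗ mmulOp B)) (fun y y' => ind S y * ind S y' * ((β * oB + m * rB) * Real.exp (-(δ * g.dist y y')))) := by
  have hnn : ∀ (c : ℝ), 0 ≤ c → ∀ y y' : g.Site, 0 ≤ ind S y * ind S y' * (c * Real.exp (-(δ * g.dist y y'))) :=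
    fun c hc y y' => mul_nonneg (mul_nonneg (ind_nonneg _ _) (ind_nonneg _ _)) (mul_nonneg hc (Real.exp_nonneg _))
  have hDM := hasMaj_idef_mmulOp (g := g) blk π (C' := B') (C := B) (o := fun _ => oB) (fun _ => hoB) hfit
  have hMB := hasMaj_mmulOp (g := g) blk (C := B) (m := fun _ => rB) (fun _ => hrB) hB
  have t1 := hasMaj_comp_diag (liftBlk (blk ∘ π) ι) (hnn β hβ) hT' hDM
  have t2 := hasMaj_comp_diag (liftBlk blk ι) (hnn m hm) hDT hMB
  rw [idef_comp (pull (liftMap π ι)) (pull (liftMap π ι)) (pull (liftMap π ι))]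
  refine (t1.add t2).mono fun y y' => le_of_eq ?_
  ring

end Pieces

/-! ## §2 The η-defect of the adjoint species commutator row -/

section Row

variable {X X' ι J : Type} [Fintype X] [Fintype X'] [Fintype ι] [Fintype J] {g : B6.Geometry} (blk : X → g.Site) (π : X' → X)
variable (τ : J → X ≃ X) (τ' : J → X' ≃ X') (n n' : ℝ) (C : X → Matrix ι ι ℝ) (C' : X' → Matrix ι ι ℝ) (A : J ⊕ J → X → Matrix ι ι ℝ) (A' : J ⊕ J → X' → Matrix ι ι ℝ)
  (hX : X → ℝ) (hX' : X' → ℝ) (G : (X × ι → ℝ) →ₗ[ℝ] (X × ι → ℝ)) (G' : (X' × ι → ℝ) →ₗ[ℝ] (X' × ι → ℝ))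

/-- ★★ **dag-n15-c FILE 53's `r_W` ROW FOR `W = V` — the η-defect of the adjoint species commutator from the cube's RIGHT-entry defects.**  Data at two spacings (coarse unprimed on
`X × ι`, fine primed on `X′ × ι`, `π : X′ → X`): FINE partition letters `|∇′^±_μh′_X| ≤ c₁`, `|h′_X∘τ′_μ − h′_X| ≤ c₀`; partition fits along `π`: `|∇′^±h′(x′) − ∇^±h(πx′)| ≤ o₁`,
`|(h′∘τ′^{±1} − h′)(x′) − (h∘τ^{±1} − h)(πx′)| ≤ o₀`; COARSE coefficient rows `Σ_k|A^±_μ(x)_{ik}| ≤ r_A`; TRANSLATED coefficient fits `Σ_k|A′⁺_μ(τ′_μ⁻¹x′) − A⁺_μ(τ_μ⁻¹(πx′))|_{ik},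
Σ_k|A′⁻_μ(τ′_μx′) − A⁻_μ(τ_μ(πx′))|_{ik} ≤ o_At`; FINE right entries `G′ ≤ 1_S1_S·βe^{−δd}`, `G′∘∇′^±_μ ≤ 1_S1_S·β₁e^{−δd}`; right-entry defects `𝔇(G′, G) ≤ 1_S1_S·m₀e^{−δd}`,
`𝔇(G′∘∇′^±_μ, G∘∇^±_μ) ≤ 1_S1_S·m₁e^{−δd}`.  Then
`𝔇(G′∘[V′, M_{h′}], G∘[V, M_h]) ≤ 1_S(y)1_S(y′)·|J|·2·(r_A(c₁m₀ + o₁β + c₀m₁ + o₀β₁) + o_At(c₁β + c₀β₁))·e^{−δd}`.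
[cite: Balaban1984PropagatorsII, (2.133)–(2.134) p.247 (shapes, transposed); Balaban1985BackgroundPropagators, (3.37) p.396, (3.52) p.400 (shapes), Thm 3.14 pp.426–427 (difference template)] -/
theorem hasMaj_idef_comp_commOp_speciesOpM {S : Set g.Site} {β β₁ c₁ c₀ o₁ o₀ m₀ m₁ rA oAt δ : ℝ} (hβ : 0 ≤ β) (hβ₁ : 0 ≤ β₁) (hc₁ : 0 ≤ c₁) (hc₀ : 0 ≤ c₀) (ho₁ : 0 ≤ o₁)
    (ho₀ : 0 ≤ o₀) (hm₀ : 0 ≤ m₀) (hm₁ : 0 ≤ m₁) (hrA : 0 ≤ rA) (hoAt : 0 ≤ oAt)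
    -- partition letters, coarse (for the coarse coefficient rows) and fine (for the product fits)
    (hh1 : ∀ μ x, |fgrad n (τ μ) hX x| ≤ c₁) (hh1b : ∀ μ x, |bgrad n (τ μ) hX x| ≤ c₁) (hh0 : ∀ μ x, |hX (τ μ x) - hX x| ≤ c₀)
    (hh1' : ∀ μ x', |fgrad n' (τ' μ) hX' x'| ≤ c₁) (hh1b' : ∀ μ x', |bgrad n' (τ' μ) hX' x'| ≤ c₁) (hh0' : ∀ μ x', |hX' (τ' μ x') - hX' x'| ≤ c₀)
    -- partition fits along π
    (hf1 : ∀ μ x', |fgrad n' (τ' μ) hX' x' - fgrad n (τ μ) hX (π x')| ≤ o₁) (hf1b : ∀ μ x', |bgrad n' (τ' μ) hX' x' - bgrad n (τ μ) hX (π x')| ≤ o₁)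
    (hf0 : ∀ μ x', |(hX' (τ' μ x') - hX' x') - (hX (τ μ (π x')) - hX (π x'))| ≤ o₀)
    (hf0b : ∀ μ x', |(hX' x' - hX' ((τ' μ).symm x')) - (hX (π x') - hX ((τ μ).symm (π x')))| ≤ o₀)
    -- coarse coefficient rows and translated coefficient fits
    (hA : ∀ j x i, ∑ k, |A j x i k| ≤ rA)
    (hfAb : ∀ μ x' i, ∑ k, |A' (Sum.inl μ) ((τ' μ).symm x') i k - A (Sum.inl μ) ((τ μ).symm (π x')) i k| ≤ oAt)
    (hfAf : ∀ μ x' i, ∑ k, |A' (Sum.inr μ) (τ' μ x') i k - A (Sum.inr μ) (τ μ (π x')) i k| ≤ oAt)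
    -- fine right entries
    (hG' : HasMaj (BlockNorm.ofBlocks g (liftBlk blk ι ∘ liftMap π ι)) (BlockNorm.ofBlocks g (liftBlk blk ι ∘ liftMap π ι)) G'
      (fun y y' => ind S y * ind S y' * (β * Real.exp (-(δ * g.dist y y')))))
    (hD' : ∀ μ, HasMaj (BlockNorm.ofBlocks g (liftBlk blk ι ∘ liftMap π ι)) (BlockNorm.ofBlocks g (liftBlk blk ι ∘ liftMap π ι)) (G' ∘ₗ fgrad n' (liftEquiv (τ' μ) ι))
      (fun y y' => ind S y * ind S y' * (β₁ * Real.exp (-(δ * g.dist y y')))))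
    (hDb' : ∀ μ, HasMaj (BlockNorm.ofBlocks g (liftBlk blk ι ∘ liftMap π ι)) (BlockNorm.ofBlocks g (liftBlk blk ι ∘ liftMap π ι)) (G' ∘ₗ bgrad n' (liftEquiv (τ' μ) ι))
      (fun y y' => ind S y * ind S y' * (β₁ * Real.exp (-(δ * g.dist y y')))))
    -- right-entry defects
    (hDG : HasMaj (BlockNorm.ofBlocks g (liftBlk blk ι)) (BlockNorm.ofBlocks g (liftBlk blk ι ∘ liftMap π ι)) (idef (pull (liftMap π ι)) (pull (liftMap π ι)) G' G)
      (fun y y' => ind S y * ind S y' * (m₀ * Real.exp (-(δ * g.dist y y')))))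
    (hDD : ∀ μ, HasMaj (BlockNorm.ofBlocks g (liftBlk blk ι)) (BlockNorm.ofBlocks g (liftBlk blk ι ∘ liftMap π ι))
      (idef (pull (liftMap π ι)) (pull (liftMap π ι)) (G' ∘ₗ fgrad n' (liftEquiv (τ' μ) ι)) (G ∘ₗ fgrad n (liftEquiv (τ μ) ι)))
      (fun y y' => ind S y * ind S y' * (m₁ * Real.exp (-(δ * g.dist y y')))))
    (hDDb : ∀ μ, HasMaj (BlockNorm.ofBlocks g (liftBlk blk ι)) (BlockNorm.ofBlocks g (liftBlk blk ι ∘ liftMap π ι))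
      (idef (pull (liftMap π ι)) (pull (liftMap π ι)) (G' ∘ₗ bgrad n' (liftEquiv (τ' μ) ι)) (G ∘ₗ bgrad n (liftEquiv (τ μ) ι)))
      (fun y y' => ind S y * ind S y' * (m₁ * Real.exp (-(δ * g.dist y y'))))) :
    HasMaj (BlockNorm.ofBlocks g (liftBlk blk ι)) (BlockNorm.ofBlocks g (liftBlk blk ι ∘ liftMap π ι))
      (idef (pull (liftMap π ι)) (pull (liftMap π ι)) (G' ∘ₗ commOp (speciesOpM τ' n' C' A') (fun p' : X' × ι => hX' p'.1))
        (G ∘ₗ commOp (speciesOpM τ n C A) (fun p : X × ι => hX p.1)))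
      (fun y y' => ind S y * ind S y' * ((Fintype.card J * (2 * (rA * (c₁ * m₀ + o₁ * β + c₀ * m₁ + o₀ * β₁) + oAt * (c₁ * β + c₀ * β₁)))) * Real.exp (-(δ * g.dist y y')))) := by
  -- symmetric forms of the difference letters
  have hh0b : ∀ μ x, |hX x - hX ((τ μ).symm x)| ≤ c₀ := fun μ x => by simpa using hh0 μ ((τ μ).symm x)
  have hh0b' : ∀ μ x', |hX' x' - hX' ((τ' μ).symm x')| ≤ c₀ := fun μ x' => by simpa using hh0' μ ((τ' μ).symm x')
  -- coarse rows of the four composite coefficients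
  have r1 : ∀ μ x i, ∑ k, |(bgrad n (τ μ) hX x • A (Sum.inl μ) ((τ μ).symm x)) i k| ≤ c₁ * rA := fun μ x i => sum_abs_smul_row_le hc₁ (hh1b μ x) i (hA _ _ i)
  have r2 : ∀ μ x i, ∑ k, |((hX x - hX ((τ μ).symm x)) • A (Sum.inl μ) ((τ μ).symm x)) i k| ≤ c₀ * rA := fun μ x i => sum_abs_smul_row_le hc₀ (hh0b μ x) i (hA _ _ i)
  have r3 : ∀ μ x i, ∑ k, |(fgrad n (τ μ) hX x • A (Sum.inr μ) (τ μ x)) i k| ≤ c₁ * rA := fun μ x i => sum_abs_smul_row_le hc₁ (hh1 μ x) i (hA _ _ i)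
  have r4 : ∀ μ x i, ∑ k, |((hX (τ μ x) - hX x) • A (Sum.inr μ) (τ μ x)) i k| ≤ c₀ * rA := fun μ x i => sum_abs_smul_row_le hc₀ (hh0 μ x) i (hA _ _ i)
  -- fits of the four composite coefficients along π (product fits: fine partition letter × translated coefficient fit + partition fit × coarse rows)
  have o1 : ∀ μ x' i, ∑ k, |(bgrad n' (τ' μ) hX' x' • A' (Sum.inl μ) ((τ' μ).symm x')) i k - (bgrad n (τ μ) hX (π x') • A (Sum.inl μ) ((τ μ).symm (π x'))) i k| ≤ c₁ * oAt + o₁ * rA :=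
    fun μ x' i => sum_abs_smul_row_fit_le hc₁ (hh1b' μ x') i (hfAb μ x' i) (hf1b μ x') (hA _ _ i)
  have o2 : ∀ μ x' i, ∑ k, |((hX' x' - hX' ((τ' μ).symm x')) • A' (Sum.inl μ) ((τ' μ).symm x')) i k - ((hX (π x') - hX ((τ μ).symm (π x'))) • A (Sum.inl μ) ((τ μ).symm (π x'))) i k| ≤
      c₀ * oAt + o₀ * rA := fun μ x' i => sum_abs_smul_row_fit_le hc₀ (hh0b' μ x') i (hfAb μ x' i) (hf0b μ x') (hA _ _ i)
  have o3 : ∀ μ x' i, ∑ k, |(fgrad n' (τ' μ) hX' x' • A' (Sum.inr μ) (τ' μ x')) i k - (fgrad n (τ μ) hX (π x') • A (Sum.inr μ) (τ μ (π x'))) i k| ≤ c₁ * oAt + o₁ * rA :=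
    fun μ x' i => sum_abs_smul_row_fit_le hc₁ (hh1' μ x') i (hfAf μ x' i) (hf1 μ x') (hA _ _ i)
  have o4 : ∀ μ x' i, ∑ k, |((hX' (τ' μ x') - hX' x') • A' (Sum.inr μ) (τ' μ x')) i k - ((hX (τ μ (π x')) - hX (π x')) • A (Sum.inr μ) (τ μ (π x'))) i k| ≤ c₀ * oAt + o₀ * rA :=
    fun μ x' i => sum_abs_smul_row_fit_le hc₀ (hh0' μ x') i (hfAf μ x' i) (hf0 μ x') (hA _ _ i)
  have hterm : ∀ μ, HasMaj (BlockNorm.ofBlocks g (liftBlk blk ι)) (BlockNorm.ofBlocks g (liftBlk blk ι ∘ liftMap π ι))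
      (idef (pull (liftMap π ι)) (pull (liftMap π ι))
        (G' ∘ₗ mmulOp (fun x' => bgrad n' (τ' μ) hX' x' • A' (Sum.inl μ) ((τ' μ).symm x')) +
            (G' ∘ₗ fgrad n' (liftEquiv (τ' μ) ι)) ∘ₗ mmulOp (fun x' => (hX' x' - hX' ((τ' μ).symm x')) • A' (Sum.inl μ) ((τ' μ).symm x')) +
          (G' ∘ₗ mmulOp (fun x' => fgrad n' (τ' μ) hX' x' • A' (Sum.inr μ) (τ' μ x')) -
            (G' ∘ₗ bgrad n' (liftEquiv (τ' μ) ι)) ∘ₗ mmulOp (fun x' => (hX' (τ' μ x') - hX' x') • A' (Sum.inr μ) (τ' μ x'))))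
        (G ∘ₗ mmulOp (fun x => bgrad n (τ μ) hX x • A (Sum.inl μ) ((τ μ).symm x)) +
            (G ∘ₗ fgrad n (liftEquiv (τ μ) ι)) ∘ₗ mmulOp (fun x => (hX x - hX ((τ μ).symm x)) • A (Sum.inl μ) ((τ μ).symm x)) +
          (G ∘ₗ mmulOp (fun x => fgrad n (τ μ) hX x • A (Sum.inr μ) (τ μ x)) -
            (G ∘ₗ bgrad n (liftEquiv (τ μ) ι)) ∘ₗ mmulOp (fun x => (hX (τ μ x) - hX x) • A (Sum.inr μ) (τ μ x)))))
      (fun y y' => ind S y * ind S y' * ((2 * (rA * (c₁ * m₀ + o₁ * β + c₀ * m₁ + o₀ * β₁) + oAt * (c₁ * β + c₀ * β₁))) * Real.exp (-(δ * g.dist y y')))) := fun μ => by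
    have t1 := hasMaj_idef_comp_mmulOp_loc blk π hβ (by positivity) hm₀ (by positivity) (r1 μ) (o1 μ) hG' hDG
    have t2 := hasMaj_idef_comp_mmulOp_loc blk π hβ₁ (by positivity) hm₁ (by positivity) (r2 μ) (o2 μ) (hD' μ) (hDD μ)
    have t3 := hasMaj_idef_comp_mmulOp_loc blk π hβ (by positivity) hm₀ (by positivity) (r3 μ) (o3 μ) hG' hDG
    have t4 := hasMaj_idef_comp_mmulOp_loc blk π hβ₁ (by positivity) hm₁ (by positivity) (r4 μ) (o4 μ) (hDb' μ) (hDDb μ)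
    rw [idef_add, idef_add, idef_sub]
    refine ((t1.add t2).add (t3.sub t4)).mono fun y y' => le_of_eq ?_
    ring
  rw [comp_commOp_speciesOpM, comp_commOp_speciesOpM, idef_fsum]
  refine (hasMaj_fsum (b₁ := BlockNorm.ofBlocks g (liftBlk blk ι)) (b₃ := BlockNorm.ofBlocks g (liftBlk blk ι ∘ liftMap π ι)) Finset.univ _ _
    fun μ _ => hterm μ).mono fun y y' => le_of_eq ?_
  simp only [Finset.sum_const, Finset.card_univ, nsmul_eq_mul]
  ring

/-- ★ THE `r_W` ROW FOR `W = −V` (the sign of (3.53)): `𝔇(G′∘[−V′, M_{h′}], G∘[−V, M_h])` has the same letter. [cite: Balaban1985BackgroundPropagators, (3.53) p.400 (shape)] -/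
theorem hasMaj_idef_comp_commOp_neg_speciesOpM {S : Set g.Site} {β β₁ c₁ c₀ o₁ o₀ m₀ m₁ rA oAt δ : ℝ} (hβ : 0 ≤ β) (hβ₁ : 0 ≤ β₁) (hc₁ : 0 ≤ c₁) (hc₀ : 0 ≤ c₀) (ho₁ : 0 ≤ o₁)
    (ho₀ : 0 ≤ o₀) (hm₀ : 0 ≤ m₀) (hm₁ : 0 ≤ m₁) (hrA : 0 ≤ rA) (hoAt : 0 ≤ oAt)
    (hh1 : ∀ μ x, |fgrad n (τ μ) hX x| ≤ c₁) (hh1b : ∀ μ x, |bgrad n (τ μ) hX x| ≤ c₁) (hh0 : ∀ μ x, |hX (τ μ x) - hX x| ≤ c₀)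
    (hh1' : ∀ μ x', |fgrad n' (τ' μ) hX' x'| ≤ c₁) (hh1b' : ∀ μ x', |bgrad n' (τ' μ) hX' x'| ≤ c₁) (hh0' : ∀ μ x', |hX' (τ' μ x') - hX' x'| ≤ c₀)
    (hf1 : ∀ μ x', |fgrad n' (τ' μ) hX' x' - fgrad n (τ μ) hX (π x')| ≤ o₁) (hf1b : ∀ μ x', |bgrad n' (τ' μ) hX' x' - bgrad n (τ μ) hX (π x')| ≤ o₁)
    (hf0 : ∀ μ x', |(hX' (τ' μ x') - hX' x') - (hX (τ μ (π x')) - hX (π x'))| ≤ o₀)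
    (hf0b : ∀ μ x', |(hX' x' - hX' ((τ' μ).symm x')) - (hX (π x') - hX ((τ μ).symm (π x')))| ≤ o₀)
    (hA : ∀ j x i, ∑ k, |A j x i k| ≤ rA)
    (hfAb : ∀ μ x' i, ∑ k, |A' (Sum.inl μ) ((τ' μ).symm x') i k - A (Sum.inl μ) ((τ μ).symm (π x')) i k| ≤ oAt)
    (hfAf : ∀ μ x' i, ∑ k, |A' (Sum.inr μ) (τ' μ x') i k - A (Sum.inr μ) (τ μ (π x')) i k| ≤ oAt)
    (hG' : HasMaj (BlockNorm.ofBlocks g (liftBlk blk ι ∘ liftMap π ι)) (BlockNorm.ofBlocks g (liftBlk blk ι ∘ liftMap π ι)) G'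
      (fun y y' => ind S y * ind S y' * (β * Real.exp (-(δ * g.dist y y')))))
    (hD' : ∀ μ, HasMaj (BlockNorm.ofBlocks g (liftBlk blk ι ∘ liftMap π ι)) (BlockNorm.ofBlocks g (liftBlk blk ι ∘ liftMap π ι)) (G' ∘ₗ fgrad n' (liftEquiv (τ' μ) ι))
      (fun y y' => ind S y * ind S y' * (β₁ * Real.exp (-(δ * g.dist y y')))))
    (hDb' : ∀ μ, HasMaj (BlockNorm.ofBlocks g (liftBlk blk ι ∘ liftMap π ι)) (BlockNorm.ofBlocks g (liftBlk blk ι ∘ liftMap π ι)) (G' ∘ₗ bgrad n' (liftEquiv (τ' μ) ι))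
      (fun y y' => ind S y * ind S y' * (β₁ * Real.exp (-(δ * g.dist y y')))))
    (hDG : HasMaj (BlockNorm.ofBlocks g (liftBlk blk ι)) (BlockNorm.ofBlocks g (liftBlk blk ι ∘ liftMap π ι)) (idef (pull (liftMap π ι)) (pull (liftMap π ι)) G' G)
      (fun y y' => ind S y * ind S y' * (m₀ * Real.exp (-(δ * g.dist y y')))))
    (hDD : ∀ μ, HasMaj (BlockNorm.ofBlocks g (liftBlk blk ι)) (BlockNorm.ofBlocks g (liftBlk blk ι ∘ liftMap π ι))
      (idef (pull (liftMap π ι)) (pull (liftMap π ι)) (G' ∘ₗ fgrad n' (liftEquiv (τ' μ) ι)) (G ∘ₗ fgrad n (liftEquiv (τ μ) ι)))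
      (fun y y' => ind S y * ind S y' * (m₁ * Real.exp (-(δ * g.dist y y')))))
    (hDDb : ∀ μ, HasMaj (BlockNorm.ofBlocks g (liftBlk blk ι)) (BlockNorm.ofBlocks g (liftBlk blk ι ∘ liftMap π ι))
      (idef (pull (liftMap π ι)) (pull (liftMap π ι)) (G' ∘ₗ bgrad n' (liftEquiv (τ' μ) ι)) (G ∘ₗ bgrad n (liftEquiv (τ μ) ι)))
      (fun y y' => ind S y * ind S y' * (m₁ * Real.exp (-(δ * g.dist y y'))))) :
    HasMaj (BlockNorm.ofBlocks g (liftBlk blk ι)) (BlockNorm.ofBlocks g (liftBlk blk ι ∘ liftMap π ι))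
      (idef (pull (liftMap π ι)) (pull (liftMap π ι)) (G' ∘ₗ commOp (-speciesOpM τ' n' C' A') (fun p' : X' × ι => hX' p'.1))
        (G ∘ₗ commOp (-speciesOpM τ n C A) (fun p : X × ι => hX p.1)))
      (fun y y' => ind S y * ind S y' * ((Fintype.card J * (2 * (rA * (c₁ * m₀ + o₁ * β + c₀ * m₁ + o₀ * β₁) + oAt * (c₁ * β + c₀ * β₁)))) * Real.exp (-(δ * g.dist y y')))) := by
  rw [comp_commOp_neg, comp_commOp_neg, idef_neg]
  exact (hasMaj_idef_comp_commOp_speciesOpM blk π τ τ' n n' C C' A A' hX hX' G G' hβ hβ₁ hc₁ hc₀ ho₁ ho₀ hm₀ hm₁ hrA hoAt hh1 hh1b hh0 hh1' hh1b' hh0' hf1 hf1b hf0 hf0b hA hfAb hfAf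
    hG' hD' hDb' hDG hDD hDDb).neg

end Row

end Summit.QuantumFields.YangMills.BalabanUVNodes.N15.CurvedSpecies

end
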